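import Summits.QuantumFields.QCD.Theorems.QuarksNoInfraredClauseThinQCDReindexTransport
import Summits.QuantumFields.QCD.Theorems.QuarksNoInfraredClauseThinQCDOfPieces
import HarnessLib

/-!
# Crux `ThinQCD` (item stmt-QuantumFields-17278) from the pieces of skeleton r5 — and from the THIN pieces

Support file of line `registered` (route `QuarksNoInfraredClause`, sub-problem QCD; `--supports stmt-QuantumFields-17278`),
the r5 analogue of `…ThinQCDOfPieces.lean` (p155285, r4).  Two kernel-checked implications, no `sorry`, no definition:

* `thinQCD_of_pieces_r5` — THE ITEM-LEVEL UPPER BRACKET of the crux after reshape r5 (`Cruxes/ThinQCD/RESHAPE-r5.md`):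
  (S1′ the chiral lattice half: ∃ reg with mass scaling, chiral at zero, two-loop scaling, ∀ m>0 branch + FULL uniform lattice
  gap) → (U1 the calibrated lattice package along a chirality-keeping reindexing: Goldstone bound, ⁰𝒮-tightness locally
  uniform in the masses, mass-Lipschitz, and per tuple biting calibrations / κ₃ / (T∧COMP) / CL / CS) →
  `CounterexampleMustBeHot.RotationRestoration` (8840) → `ThinQCD`.  The diagonal extraction DE is the LANDED
  `Summit.QuantumFields.QCD.Theorems.ThinQCD.stub_diagonalExtraction` (p167000), the OS closure the landed
  `ConvergentOSClosure.stub_closureOfLatticeInputs`; the witness is `reg₁.restrict ψ` with the reindexed calibrated family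
  (built as a term; `…ThinQCDReindexTransport.lean`).
* `thinQCD_of_thin` — THE ROUTE'S THESIS AT THE LEVEL OF THIS CRUX: the same with the NEUTRAL lattice gap everywhere (r4's thin
  anchor; the package and rotation restoration asked under the neutral gap), through the landed GAP-FREE closure
  `closureOfLatticeInputs_noGap` (R″, p167771): the thin crux needs NO half-spectrum lemma (`TorusHalfSpectrum`, found
  misstated as filed by three leads of stmt-9508) once the neighbours 18044 / 8840 thin their idle resp. neutral-sufficient gap
  hypothesis.

References: Osterwalder–Schrader II (1975) §2, §4; Glimm–Jaffe (1987) §6.1; Montvay–Münster (1994) §1.7, §5.1.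
-/

noncomputable section

namespace Summit.QuantumFields.QCD.Theorems.ThinQCD.R5

open scoped BigOperators Topology SchwartzMap
open MeasureTheory Filter
open Literature.MathematicalPhysics.QuantumFieldTheory Literature.MathematicalPhysics.QuantumLattice
  Literature.MathematicalPhysics.AQFT
open Summit.QuantumFields.QCD.Cruxes.StableActionBridge.Sketch (qcdLatticeDist qcdLatticeDistSymAP
  qcdLatticeSchwinger_eq_qcdLatticeDist)
open Summit.QuantumFields.QCD.Theorems.ConvergentOSClosure (stub_closureOfLatticeInputs)
open Summit.QuantumFields.QCD.Cruxes.ThinQCD.Registered (closureOfLatticeInputs_noGap vecCons_one_eq_const)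
open Summit.QuantumFields.QCD.Theorems.RobustYangMillsHandover.Negative (hasMassGap_anti)

variable {Nf : ℕ}

/-! ## The crux from the r5 pieces -/

/-- **`ThinQCD` from S1′, U1 and `RotationRestoration`** (DE and the OS closure are landed theorems). -/
theorem thinQCD_of_pieces_r5 :
    (∀ Nf : ℕ, Nf = 2 ∨ Nf = 3 → ∃ reg : QCDRegularisation Nf,
          reg.HasMassScaling ∧ reg.IsChiralAtZero ∧ (reg.scheme 0 0 0).HasAsymptoticScaling ∧
            ∀ m : Fin Nf → ℝ, (∀ f, 0 < m f) →
              (∀ f, ∀ᶠ k in Filter.atTop, -1 < (reg.scheme m 0 0).mq f k) ∧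
                ∃ Δ > 0, (reg.scheme m 0 0).HasLatticeMassGap Δ) →
    (∀ Nf : ℕ, Nf = 2 ∨ Nf = 3 → ∀ reg : QCDRegularisation Nf, reg.HasMassScaling → reg.IsChiralAtZero →
          (reg.scheme 0 0 0).HasAsymptoticScaling →
          (∀ m : Fin Nf → ℝ, (∀ f, 0 < m f) →
            (∀ f, ∀ᶠ k in Filter.atTop, -1 < (reg.scheme m 0 0).mq f k) ∧ ∃ Δ > 0, (reg.scheme m 0 0).HasLatticeMassGap Δ) →
          ∃ (φ : ℕ → ℕ) (reg₁ : QCDRegularisation Nf), StrictMono φ ∧ reg₁.a = reg.a ∘ φ ∧ reg₁.β = reg.β ∘ φ ∧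
            reg₁.mcrit = reg.mcrit ∘ φ ∧ reg₁.Zm = reg.Zm ∘ φ ∧ (∀ k, reg.L (φ k) ≤ reg₁.L k) ∧ reg₁.HasGoldstoneBound ∧
            ∃ 𝒞 : CalibratedSpeciesFamily reg₁,
              (∀ K : Set (Fin Nf → ℝ), IsCompact K → K ⊆ {m | ∀ fl, 0 < m fl} →
                ∃ (s : ℕ) (α β : ℝ), 0 ≤ α ∧ ∀ (n : ℕ) (σ : Fin n → QCDField Nf), ∀ᶠ k in Filter.atTop, ∀ m ∈ K,
                  ∀ F : SchwartzMap (Fin n → EuclideanSpace ℝ (Fin 4)) ℂ, IsOffDiagonal F →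
                    ‖qcdLatticeDist (𝒞.scheme m) k n σ F‖ ≤ α * (n.factorial : ℝ) ^ β * schwartzNorm (n * s) F) ∧
              (∀ (n : ℕ) (σ : Fin n → QCDField Nf) (F : SchwartzMap (Fin n → EuclideanSpace ℝ (Fin 4)) ℂ),
                IsOffDiagonal F → ∀ K : Set (Fin Nf → ℝ), IsCompact K → K ⊆ {m | ∀ fl, 0 < m fl} →
                  ∃ C : ℝ, ∀ᶠ k in Filter.atTop, ∀ m ∈ K, ∀ m' ∈ K,
                    ‖qcdLatticeDist (𝒞.scheme m) k n σ F - qcdLatticeDist (𝒞.scheme m') k n σ F‖ ≤ C * ‖m - m'‖) ∧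
              ∀ m : Fin Nf → ℝ, (∀ f, 0 < m f) →
                (∀ᶠ k in Filter.atTop,
                  (𝒞.scheme m).twoPoint k QCDField.glue QCDField.glue (thetaTest 4 𝒞.f₀) 𝒞.f₀ = 1) ∧
                (∀ f g : Fin Nf, f ≠ g → ∀ᶠ k in Filter.atTop,
                  (𝒞.scheme m).twoPoint k (QCDField.pseudoRe f g) (QCDField.pseudoRe f g) (thetaTest 4 𝒞.f₀) 𝒞.f₀ = 1) ∧
                (∃ f g h : SchwartzMap (EuclideanSpace ℝ (Fin 4)) ℝ,
                  tsupport (f : EuclideanSpace ℝ (Fin 4) → ℝ) ⊆ {x | x 0 < 0} ∧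
                  tsupport (g : EuclideanSpace ℝ (Fin 4) → ℝ) ⊆ {x | 0 < x 0 ∧ x 0 < 1} ∧
                  tsupport (h : EuclideanSpace ℝ (Fin 4) → ℝ) ⊆ {x | 1 < x 0} ∧
                  ∃ ε > (0 : ℝ), ∀ᶠ k in Filter.atTop, ε ≤ ‖qcdLatticeSchwinger (𝒞.scheme m) k 3
                    ![QCDField.glue, QCDField.glue, QCDField.glue] ![f, g, h] -
                    qcdLatticeSchwinger (𝒞.scheme m) k 1 ![QCDField.glue] ![f] *
                      qcdLatticeSchwinger (𝒞.scheme m) k 2 ![QCDField.glue, QCDField.glue] ![g, h] -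
                    qcdLatticeSchwinger (𝒞.scheme m) k 1 ![QCDField.glue] ![g] *
                      qcdLatticeSchwinger (𝒞.scheme m) k 2 ![QCDField.glue, QCDField.glue] ![f, h] -
                    qcdLatticeSchwinger (𝒞.scheme m) k 1 ![QCDField.glue] ![h] *
                      qcdLatticeSchwinger (𝒞.scheme m) k 2 ![QCDField.glue, QCDField.glue] ![f, g] +
                    2 * (qcdLatticeSchwinger (𝒞.scheme m) k 1 ![QCDField.glue] ![f] *
                      qcdLatticeSchwinger (𝒞.scheme m) k 1 ![QCDField.glue] ![g] *
                      qcdLatticeSchwinger (𝒞.scheme m) k 1 ![QCDField.glue] ![h])‖) ∧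
                (∃ (s : ℕ) (α β : ℝ), 0 ≤ α ∧
                  (∀ (n : ℕ) (σ : Fin n → QCDField Nf), ∀ᶠ k in Filter.atTop,
                    ∀ F : SchwartzMap (Fin n → EuclideanSpace ℝ (Fin 4)) ℂ, IsOffDiagonal F →
                      ‖qcdLatticeDist (𝒞.scheme m) k n σ F‖ ≤ α * (n.factorial : ℝ) ^ β * schwartzNorm (n * s) F) ∧
                  (∀ ε : ℝ, 0 < ε → ∀ (n : ℕ) (σ : Fin n → QCDField Nf), ∀ᶠ k in Filter.atTop,
                    ∀ F : SchwartzMap (Fin n → EuclideanSpace ℝ (Fin 4)) ℂ, IsOffDiagonal F →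
                      ‖qcdLatticeDistSymAP (𝒞.scheme m) k n σ F - qcdLatticeDist (𝒞.scheme m) k n σ F‖ ≤
                        ε * schwartzNorm (n * s) F)) ∧
                (∀ (n n' : ℕ) (σ : Fin n → QCDField Nf) (σ' : Fin n' → QCDField Nf)
                  (F : SchwartzMap (Fin n → EuclideanSpace ℝ (Fin 4)) ℂ) (G : SchwartzMap (Fin n' → EuclideanSpace ℝ (Fin 4)) ℂ),
                  IsTimeOrdered F → IsTimeOrdered G → ∀ a : EuclideanSpace ℝ (Fin 4), a 0 = 0 → a ≠ 0 →
                  ∀ ε : ℝ, 0 < ε → ∃ t₀ : ℝ, ∀ t : ℝ, t₀ ≤ t →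
                    ∀ H : SchwartzMap (Fin (n + n') → EuclideanSpace ℝ (Fin 4)) ℂ,
                      IsAppendTensorOf H (osAdjoint F) (translateMulti (t • a) G) →
                      ∀ᶠ k in Filter.atTop, ‖qcdLatticeDist (𝒞.scheme m) k (n + n') (Fin.append (σ ∘ Fin.rev) σ') H -
                        qcdLatticeDist (𝒞.scheme m) k n (σ ∘ Fin.rev) (osAdjoint F) *
                          qcdLatticeDist (𝒞.scheme m) k n' σ' G‖ ≤ ε) ∧
                (∃ Δ' > 0, (𝒞.scheme m).HasSpeciesCSClustering Δ')) →
    Summit.QuantumFields.QCD.Theses.CounterexampleMustBeHot.RotationRestoration →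
    Summit.QuantumFields.QCD.Theses.QuarksNoInfraredClause.ThinQCD := by
  intro hA hU hR Nf hNf
  have hNf16 : Nf ≤ 16 := le_sixteen_of_two_or_three hNf
  -- S1′: the chiral lattice half
  obtain ⟨reg, hms, hchi, has, hgap⟩ := hA Nf hNf
  -- U1: the calibrated lattice package along `φ`
  obtain ⟨φ, reg₁, hφ, ha, hβ, hmc, hZm, hL, hG, 𝒞, hT, hLip, hper⟩ := hU Nf hNf reg hms hchi has hgap
  -- DE: the diagonal extraction `ψ`
  obtain ⟨ψ, hψ, hconvψ⟩ := Summit.QuantumFields.QCD.Theorems.ThinQCD.stub_diagonalExtraction Nf reg₁ 𝒞 hT hLip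
  have hψt : Tendsto ψ atTop atTop := hψ.tendsto_atTop
  -- the reindexed calibrated family over `reg₁.restrict ψ` (term-level bookkeeping: renormalisations `z_s(m, ψ k)`,
  -- `shift_s(m, ψ k)`, same reference pair; one-point subtraction and calibration inherited definitionally)
  obtain ⟨𝒞₂, hz, hshift, hf₀⟩ : ∃ 𝒞₂ : CalibratedSpeciesFamily (reg₁.restrict ψ hψt),
      (∀ m s k, 𝒞₂.z m s k = 𝒞.z m s (ψ k)) ∧ (∀ m s k, 𝒞₂.shift m s k = 𝒞.shift m s (ψ k)) ∧ 𝒞₂.f₀ = 𝒞.f₀ :=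
    ⟨{ τ₀ := 𝒞.τ₀, τ₀_pos := 𝒞.τ₀_pos, f₀ := 𝒞.f₀, f₀_ne_zero := 𝒞.f₀_ne_zero, tsupport_f₀ := 𝒞.tsupport_f₀,
       z := fun m s k => 𝒞.z m s (ψ k), shift := fun m s k => 𝒞.shift m s (ψ k),
       z_pos := fun m s k => 𝒞.z_pos m s (ψ k),
       onePointSubtracted := fun m s k f => 𝒞.onePointSubtracted m s (ψ k) f,
       calibrated := fun m s k => 𝒞.calibrated m s (ψ k) }, fun _ _ _ => rfl, fun _ _ _ => rfl, rfl⟩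
  -- the witness: `reg₁.restrict ψ` with the reindexed family `reindex 𝒞 ψ`, chiral by the Goldstone bound
  refine ⟨reg₁.restrict ψ hψt, hasMassScaling_transport hφ hψt ha hZm hms, (hG.restrict ψ hψt).isChiralAtZero,
    fun m hm => ?_⟩
  obtain ⟨hbr, Δ, hΔ, hgapm⟩ := hgap m hm
  obtain ⟨h2g, h2q, h3g, ⟨s, α, β, hα, hb, hcomp⟩, hcl, Δ', hΔ', hCS'⟩ := hper m hm
  have has₂ := hasAsymptoticScaling_transport hφ 𝒞₂ ha hβ has m
  have hbr₂ := branch_transport hφ 𝒞₂ ha hmc hZm hbr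
  have hgap₂ := gap_transport hφ 𝒞₂ ha hβ hmc hZm hL hgapm
  have h2g₂ := twoPoint_glue_reindex 𝒞 ψ hψt 𝒞₂ hz hshift hf₀ h2g
  have h2q₂ := twoPoint_pseudoRe_reindex 𝒞 ψ hψt 𝒞₂ hz hshift hf₀ h2q
  have h3g₂ := kappa3_reindex 𝒞 ψ hψt 𝒞₂ hz hshift h3g
  have hb₂ := bound_reindex 𝒞 ψ hψt 𝒞₂ hz hshift hb
  have hcomp₂ := comp_reindex 𝒞 ψ hψt 𝒞₂ hz hshift hcomp
  have hcl₂ := cl_reindex 𝒞 ψ hψt 𝒞₂ hz hshift hcl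
  have hCS₂ := hasSpeciesCSClustering_reindex 𝒞 ψ hψt 𝒞₂ hz hshift hCS'
  have hconv₂ := converges_reindex 𝒞 ψ hψt 𝒞₂ hz hshift (hconvψ m hm)
  -- the OS closure of the lattice-side inputs (landed, scheme-generic, `N_f ≤ 16`)
  obtain ⟨S, h0, h0', hE0', hE1t, hE2, hE3, hE4, htensor, Δ₁, hΔ₁, hGapS, hGapL⟩ :=
    stub_closureOfLatticeInputs Nf (𝒞₂.scheme m) hNf16 has₂ hbr₂ hconv₂ s α β hα hb₂ hcomp₂ hcl₂
      Δ Δ' hΔ hΔ' hgap₂ hCS₂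
  -- E1, packaging
  have hE1 := hR Nf (𝒞₂.scheme m) has₂ hbr₂ ⟨Δ₁, hΔ₁, hGapL⟩ S htensor
  let T : OSData (QCDField Nf) 4 := OSData.ofAxioms S ⟨⟨h0, h0', ⟨hE1t, hE1⟩, hE2, hE3, hE4⟩, hE0'⟩
  -- the crux body at `m`
  refine ⟨𝒞₂.z m, 𝒞₂.shift m, T, ⟨has₂, hbr₂, htensor⟩, ?_, ?_, h3g₂, Δ₁ / 2,
    half_pos hΔ₁, hasMassGap_anti T (show Δ₁ / 2 ≤ Δ₁ by linarith) hGapS,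
    hGapL.neutral.mono (show 2 * (Δ₁ / 2) ≤ Δ₁ by linarith)⟩
  · -- 2-point window of `glue`: the glue calibration at the reference pair (value `1`, one-point functions subtracted)
    refine ⟨thetaTest 4 𝒞₂.f₀, 𝒞₂.f₀, fun x hx => ?_, fun x hx => ?_, 1, one_pos,
      h2g₂.mono fun k hk => ?_⟩
    · have h := (mem_timeSlab.1 (𝒞₂.tsupport_thetaTest_f₀ hx)).2
      show x 0 < 0
      linarith [𝒞₂.τ₀_pos]
    · have h := (mem_timeSlab.1 (𝒞₂.tsupport_f₀ hx)).1
      show 0 < x 0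
      linarith [𝒞₂.τ₀_pos]
    · have h1 : qcdLatticeSchwinger ((reg₁.restrict ψ hψt).scheme m (𝒞₂.z m)
          (𝒞₂.shift m)) k 1 ![QCDField.glue] ![thetaTest 4 𝒞₂.f₀] = 0 := by
        rw [vecCons_one_eq_const, vecCons_one_eq_const]; exact 𝒞₂.onePoint_eq_zero m _ k _
      have h2 : qcdLatticeSchwinger ((reg₁.restrict ψ hψt).scheme m (𝒞₂.z m)
          (𝒞₂.shift m)) k 2 ![QCDField.glue, QCDField.glue]
          ![thetaTest 4 𝒞₂.f₀, 𝒞₂.f₀] = 1 := hk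
      rw [h2, h1, zero_mul, sub_zero, norm_one]
  · -- 2-point windows of the flavour-changing `pseudoRe f₁ f₂`: the `pseudoRe` calibration
    intro f₁ f₂ hne
    refine ⟨thetaTest 4 𝒞₂.f₀, 𝒞₂.f₀, fun x hx => ?_, fun x hx => ?_, 1, one_pos,
      (h2q₂ f₁ f₂ hne).mono fun k hk => ?_⟩
    · have h := (mem_timeSlab.1 (𝒞₂.tsupport_thetaTest_f₀ hx)).2
      show x 0 < 0
      linarith [𝒞₂.τ₀_pos]
    · have h := (mem_timeSlab.1 (𝒞₂.tsupport_f₀ hx)).1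
      show 0 < x 0
      linarith [𝒞₂.τ₀_pos]
    · have h1 : qcdLatticeSchwinger ((reg₁.restrict ψ hψt).scheme m (𝒞₂.z m)
          (𝒞₂.shift m)) k 1 ![QCDField.pseudoRe f₁ f₂] ![thetaTest 4 𝒞₂.f₀] = 0 := by
        rw [vecCons_one_eq_const, vecCons_one_eq_const]; exact 𝒞₂.onePoint_eq_zero m _ k _
      have h2 : qcdLatticeSchwinger ((reg₁.restrict ψ hψt).scheme m (𝒞₂.z m)
          (𝒞₂.shift m)) k 2 ![QCDField.pseudoRe f₁ f₂, QCDField.pseudoRe f₁ f₂]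
          ![thetaTest 4 𝒞₂.f₀, 𝒞₂.f₀] = 1 := hk
      rw [h2, h1, zero_mul, sub_zero, norm_one]


/-! ## The crux from the THIN pieces -/

/-- **`ThinQCD` from the thin anchor, the thin package and thin rotation restoration** — no half-spectrum lemma, no full
lattice gap (DE landed; gap-free closure R″ landed). -/
theorem thinQCD_of_thin :
    (∀ Nf : ℕ, Nf = 2 ∨ Nf = 3 → ∃ reg : QCDRegularisation Nf,
          reg.HasMassScaling ∧ reg.IsChiralAtZero ∧ (reg.scheme 0 0 0).HasAsymptoticScaling ∧
            ∀ m : Fin Nf → ℝ, (∀ f, 0 < m f) →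
              (∀ f, ∀ᶠ k in Filter.atTop, -1 < (reg.scheme m 0 0).mq f k) ∧
                ∃ Δ₀ : ℝ, 0 < Δ₀ ∧ (reg.scheme m 0 0).HasNeutralLatticeMassGap Δ₀) →
    (∀ Nf : ℕ, Nf = 2 ∨ Nf = 3 → ∀ reg : QCDRegularisation Nf, reg.HasMassScaling → reg.IsChiralAtZero →
          (reg.scheme 0 0 0).HasAsymptoticScaling →
          (∀ m : Fin Nf → ℝ, (∀ f, 0 < m f) →
            (∀ f, ∀ᶠ k in Filter.atTop, -1 < (reg.scheme m 0 0).mq f k) ∧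
              ∃ Δ₀ : ℝ, 0 < Δ₀ ∧ (reg.scheme m 0 0).HasNeutralLatticeMassGap Δ₀) →
          ∃ (φ : ℕ → ℕ) (reg₁ : QCDRegularisation Nf), StrictMono φ ∧ reg₁.a = reg.a ∘ φ ∧ reg₁.β = reg.β ∘ φ ∧
            reg₁.mcrit = reg.mcrit ∘ φ ∧ reg₁.Zm = reg.Zm ∘ φ ∧ (∀ k, reg.L (φ k) ≤ reg₁.L k) ∧ reg₁.HasGoldstoneBound ∧
            ∃ 𝒞 : CalibratedSpeciesFamily reg₁,
              (∀ K : Set (Fin Nf → ℝ), IsCompact K → K ⊆ {m | ∀ fl, 0 < m fl} →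
                ∃ (s : ℕ) (α β : ℝ), 0 ≤ α ∧ ∀ (n : ℕ) (σ : Fin n → QCDField Nf), ∀ᶠ k in Filter.atTop, ∀ m ∈ K,
                  ∀ F : SchwartzMap (Fin n → EuclideanSpace ℝ (Fin 4)) ℂ, IsOffDiagonal F →
                    ‖qcdLatticeDist (𝒞.scheme m) k n σ F‖ ≤ α * (n.factorial : ℝ) ^ β * schwartzNorm (n * s) F) ∧
              (∀ (n : ℕ) (σ : Fin n → QCDField Nf) (F : SchwartzMap (Fin n → EuclideanSpace ℝ (Fin 4)) ℂ),
                IsOffDiagonal F → ∀ K : Set (Fin Nf → ℝ), IsCompact K → K ⊆ {m | ∀ fl, 0 < m fl} →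
                  ∃ C : ℝ, ∀ᶠ k in Filter.atTop, ∀ m ∈ K, ∀ m' ∈ K,
                    ‖qcdLatticeDist (𝒞.scheme m) k n σ F - qcdLatticeDist (𝒞.scheme m') k n σ F‖ ≤ C * ‖m - m'‖) ∧
              ∀ m : Fin Nf → ℝ, (∀ f, 0 < m f) →
                (∀ᶠ k in Filter.atTop,
                  (𝒞.scheme m).twoPoint k QCDField.glue QCDField.glue (thetaTest 4 𝒞.f₀) 𝒞.f₀ = 1) ∧
                (∀ f g : Fin Nf, f ≠ g → ∀ᶠ k in Filter.atTop,
                  (𝒞.scheme m).twoPoint k (QCDField.pseudoRe f g) (QCDField.pseudoRe f g) (thetaTest 4 𝒞.f₀) 𝒞.f₀ = 1) ∧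
                (∃ f g h : SchwartzMap (EuclideanSpace ℝ (Fin 4)) ℝ,
                  tsupport (f : EuclideanSpace ℝ (Fin 4) → ℝ) ⊆ {x | x 0 < 0} ∧
                  tsupport (g : EuclideanSpace ℝ (Fin 4) → ℝ) ⊆ {x | 0 < x 0 ∧ x 0 < 1} ∧
                  tsupport (h : EuclideanSpace ℝ (Fin 4) → ℝ) ⊆ {x | 1 < x 0} ∧
                  ∃ ε > (0 : ℝ), ∀ᶠ k in Filter.atTop, ε ≤ ‖qcdLatticeSchwinger (𝒞.scheme m) k 3
                    ![QCDField.glue, QCDField.glue, QCDField.glue] ![f, g, h] -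
                    qcdLatticeSchwinger (𝒞.scheme m) k 1 ![QCDField.glue] ![f] *
                      qcdLatticeSchwinger (𝒞.scheme m) k 2 ![QCDField.glue, QCDField.glue] ![g, h] -
                    qcdLatticeSchwinger (𝒞.scheme m) k 1 ![QCDField.glue] ![g] *
                      qcdLatticeSchwinger (𝒞.scheme m) k 2 ![QCDField.glue, QCDField.glue] ![f, h] -
                    qcdLatticeSchwinger (𝒞.scheme m) k 1 ![QCDField.glue] ![h] *
                      qcdLatticeSchwinger (𝒞.scheme m) k 2 ![QCDField.glue, QCDField.glue] ![f, g] +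
                    2 * (qcdLatticeSchwinger (𝒞.scheme m) k 1 ![QCDField.glue] ![f] *
                      qcdLatticeSchwinger (𝒞.scheme m) k 1 ![QCDField.glue] ![g] *
                      qcdLatticeSchwinger (𝒞.scheme m) k 1 ![QCDField.glue] ![h])‖) ∧
                (∃ (s : ℕ) (α β : ℝ), 0 ≤ α ∧
                  (∀ (n : ℕ) (σ : Fin n → QCDField Nf), ∀ᶠ k in Filter.atTop,
                    ∀ F : SchwartzMap (Fin n → EuclideanSpace ℝ (Fin 4)) ℂ, IsOffDiagonal F →
                      ‖qcdLatticeDist (𝒞.scheme m) k n σ F‖ ≤ α * (n.factorial : ℝ) ^ β * schwartzNorm (n * s) F) ∧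
                  (∀ ε : ℝ, 0 < ε → ∀ (n : ℕ) (σ : Fin n → QCDField Nf), ∀ᶠ k in Filter.atTop,
                    ∀ F : SchwartzMap (Fin n → EuclideanSpace ℝ (Fin 4)) ℂ, IsOffDiagonal F →
                      ‖qcdLatticeDistSymAP (𝒞.scheme m) k n σ F - qcdLatticeDist (𝒞.scheme m) k n σ F‖ ≤
                        ε * schwartzNorm (n * s) F)) ∧
                (∀ (n n' : ℕ) (σ : Fin n → QCDField Nf) (σ' : Fin n' → QCDField Nf)
                  (F : SchwartzMap (Fin n → EuclideanSpace ℝ (Fin 4)) ℂ) (G : SchwartzMap (Fin n' → EuclideanSpace ℝ (Fin 4)) ℂ),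
                  IsTimeOrdered F → IsTimeOrdered G → ∀ a : EuclideanSpace ℝ (Fin 4), a 0 = 0 → a ≠ 0 →
                  ∀ ε : ℝ, 0 < ε → ∃ t₀ : ℝ, ∀ t : ℝ, t₀ ≤ t →
                    ∀ H : SchwartzMap (Fin (n + n') → EuclideanSpace ℝ (Fin 4)) ℂ,
                      IsAppendTensorOf H (osAdjoint F) (translateMulti (t • a) G) →
                      ∀ᶠ k in Filter.atTop, ‖qcdLatticeDist (𝒞.scheme m) k (n + n') (Fin.append (σ ∘ Fin.rev) σ') H -
                        qcdLatticeDist (𝒞.scheme m) k n (σ ∘ Fin.rev) (osAdjoint F) *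
                          qcdLatticeDist (𝒞.scheme m) k n' σ' G‖ ≤ ε) ∧
                (∃ Δ' > 0, (𝒞.scheme m).HasSpeciesCSClustering Δ')) →
    (∀ (Nf : ℕ) (sch : QCDScheme Nf), sch.HasAsymptoticScaling → (∀ fl : Fin Nf, ∀ᶠ k in Filter.atTop, -1 < sch.mq fl k) →
          (∃ Δ : ℝ, 0 < Δ ∧ sch.HasNeutralLatticeMassGap Δ) →
          ∀ S : LabelledSchwingerFamily (QCDField Nf) (EuclideanSpace ℝ (Fin 4)),
            (∀ n : ℕ, n ≠ 0 → ∀ (σ : Fin n → QCDField Nf) (f : Fin n → SchwartzMap (EuclideanSpace ℝ (Fin 4)) ℝ)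
              (F : SchwartzMap (Fin n → EuclideanSpace ℝ (Fin 4)) ℂ), IsTensorOf F (fun i => ofRealTest (f i)) →
              IsOffDiagonal F → Filter.Tendsto (fun k : ℕ => qcdLatticeSchwinger sch k n σ f) Filter.atTop (nhds (S n σ F))) →
            ∀ (n : ℕ) (σ : Fin n → QCDField Nf) (Rot : EuclideanSpace ℝ (Fin 4) ≃ₗᵢ[ℝ] EuclideanSpace ℝ (Fin 4)),
              LinearMap.det (Rot.toLinearEquiv : EuclideanSpace ℝ (Fin 4) →ₗ[ℝ] EuclideanSpace ℝ (Fin 4)) = 1 →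
              ∀ F : SchwartzMap (Fin n → EuclideanSpace ℝ (Fin 4)) ℂ, IsOffDiagonal F → S n σ (linActMulti Rot F) = S n σ F) →
    Summit.QuantumFields.QCD.Theses.QuarksNoInfraredClause.ThinQCD := by
  intro hA hU hR Nf hNf
  have hNf16 : Nf ≤ 16 := le_sixteen_of_two_or_three hNf
  obtain ⟨reg, hms, hchi, has, hgap⟩ := hA Nf hNf
  obtain ⟨φ, reg₁, hφ, ha, hβ, hmc, hZm, hL, hG, 𝒞, hT, hLip, hper⟩ := hU Nf hNf reg hms hchi has hgap
  obtain ⟨ψ, hψ, hconvψ⟩ := Summit.QuantumFields.QCD.Theorems.ThinQCD.stub_diagonalExtraction Nf reg₁ 𝒞 hT hLip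
  have hψt : Tendsto ψ atTop atTop := hψ.tendsto_atTop
  -- the reindexed calibrated family over `reg₁.restrict ψ` (term-level bookkeeping: renormalisations `z_s(m, ψ k)`,
  -- `shift_s(m, ψ k)`, same reference pair; one-point subtraction and calibration inherited definitionally)
  obtain ⟨𝒞₂, hz, hshift, hf₀⟩ : ∃ 𝒞₂ : CalibratedSpeciesFamily (reg₁.restrict ψ hψt),
      (∀ m s k, 𝒞₂.z m s k = 𝒞.z m s (ψ k)) ∧ (∀ m s k, 𝒞₂.shift m s k = 𝒞.shift m s (ψ k)) ∧ 𝒞₂.f₀ = 𝒞.f₀ :=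
    ⟨{ τ₀ := 𝒞.τ₀, τ₀_pos := 𝒞.τ₀_pos, f₀ := 𝒞.f₀, f₀_ne_zero := 𝒞.f₀_ne_zero, tsupport_f₀ := 𝒞.tsupport_f₀,
       z := fun m s k => 𝒞.z m s (ψ k), shift := fun m s k => 𝒞.shift m s (ψ k),
       z_pos := fun m s k => 𝒞.z_pos m s (ψ k),
       onePointSubtracted := fun m s k f => 𝒞.onePointSubtracted m s (ψ k) f,
       calibrated := fun m s k => 𝒞.calibrated m s (ψ k) }, fun _ _ _ => rfl, fun _ _ _ => rfl, rfl⟩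
  refine ⟨reg₁.restrict ψ hψt, hasMassScaling_transport hφ hψt ha hZm hms, (hG.restrict ψ hψt).isChiralAtZero,
    fun m hm => ?_⟩
  obtain ⟨hbr, Δ₀, hΔ₀, hgapm⟩ := hgap m hm
  obtain ⟨h2g, h2q, h3g, ⟨s, α, β, hα, hb, hcomp⟩, hcl, Δ', hΔ', hCS'⟩ := hper m hm
  have has₂ := hasAsymptoticScaling_transport hφ 𝒞₂ ha hβ has m
  have hbr₂ := branch_transport hφ 𝒞₂ ha hmc hZm hbr
  have hgap₂ := neutralGap_transport hφ 𝒞₂ ha hβ hmc hZm hL hgapm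
  have h2g₂ := twoPoint_glue_reindex 𝒞 ψ hψt 𝒞₂ hz hshift hf₀ h2g
  have h2q₂ := twoPoint_pseudoRe_reindex 𝒞 ψ hψt 𝒞₂ hz hshift hf₀ h2q
  have h3g₂ := kappa3_reindex 𝒞 ψ hψt 𝒞₂ hz hshift h3g
  have hb₂ := bound_reindex 𝒞 ψ hψt 𝒞₂ hz hshift hb
  have hcomp₂ := comp_reindex 𝒞 ψ hψt 𝒞₂ hz hshift hcomp
  have hcl₂ := cl_reindex 𝒞 ψ hψt 𝒞₂ hz hshift hcl
  have hCS₂ := hasSpeciesCSClustering_reindex 𝒞 ψ hψt 𝒞₂ hz hshift hCS'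
  have hconv₂ := converges_reindex 𝒞 ψ hψt 𝒞₂ hz hshift (hconvψ m hm)
  -- the GAP-FREE OS closure R″ (landed)
  obtain ⟨S, h0, h0', hE0', hE1t, hE2, hE3, hE4, htensor, hGapS⟩ :=
    closureOfLatticeInputs_noGap Nf (𝒞₂.scheme m) hNf16 has₂ hbr₂ hconv₂ s α β hα hb₂ hcomp₂ hcl₂
      Δ' hΔ' hCS₂
  -- E1 (thin), packaging
  have hE1 := hR Nf (𝒞₂.scheme m) has₂ hbr₂ ⟨Δ₀, hΔ₀, hgap₂⟩ S htensor
  let T : OSData (QCDField Nf) 4 := OSData.ofAxioms S ⟨⟨h0, h0', ⟨hE1t, hE1⟩, hE2, hE3, hE4⟩, hE0'⟩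
  have hΔ : 0 < min Δ' (Δ₀ / 2) := lt_min hΔ' (half_pos hΔ₀)
  refine ⟨𝒞₂.z m, 𝒞₂.shift m, T, ⟨has₂, hbr₂, htensor⟩, ?_, ?_, h3g₂, min Δ' (Δ₀ / 2), hΔ,
    hasMassGap_anti T (min_le_left _ _) hGapS,
    hgap₂.mono (by linarith [min_le_right Δ' (Δ₀ / 2)])⟩
  · refine ⟨thetaTest 4 𝒞₂.f₀, 𝒞₂.f₀, fun x hx => ?_, fun x hx => ?_, 1, one_pos,
      h2g₂.mono fun k hk => ?_⟩
    · have h := (mem_timeSlab.1 (𝒞₂.tsupport_thetaTest_f₀ hx)).2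
      show x 0 < 0
      linarith [𝒞₂.τ₀_pos]
    · have h := (mem_timeSlab.1 (𝒞₂.tsupport_f₀ hx)).1
      show 0 < x 0
      linarith [𝒞₂.τ₀_pos]
    · have h1 : qcdLatticeSchwinger ((reg₁.restrict ψ hψt).scheme m (𝒞₂.z m)
          (𝒞₂.shift m)) k 1 ![QCDField.glue] ![thetaTest 4 𝒞₂.f₀] = 0 := by
        rw [vecCons_one_eq_const, vecCons_one_eq_const]; exact 𝒞₂.onePoint_eq_zero m _ k _
      have h2 : qcdLatticeSchwinger ((reg₁.restrict ψ hψt).scheme m (𝒞₂.z m)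
          (𝒞₂.shift m)) k 2 ![QCDField.glue, QCDField.glue]
          ![thetaTest 4 𝒞₂.f₀, 𝒞₂.f₀] = 1 := hk
      rw [h2, h1, zero_mul, sub_zero, norm_one]
  · intro f₁ f₂ hne
    refine ⟨thetaTest 4 𝒞₂.f₀, 𝒞₂.f₀, fun x hx => ?_, fun x hx => ?_, 1, one_pos,
      (h2q₂ f₁ f₂ hne).mono fun k hk => ?_⟩
    · have h := (mem_timeSlab.1 (𝒞₂.tsupport_thetaTest_f₀ hx)).2
      show x 0 < 0
      linarith [𝒞₂.τ₀_pos]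
    · have h := (mem_timeSlab.1 (𝒞₂.tsupport_f₀ hx)).1
      show 0 < x 0
      linarith [𝒞₂.τ₀_pos]
    · have h1 : qcdLatticeSchwinger ((reg₁.restrict ψ hψt).scheme m (𝒞₂.z m)
          (𝒞₂.shift m)) k 1 ![QCDField.pseudoRe f₁ f₂] ![thetaTest 4 𝒞₂.f₀] = 0 := by
        rw [vecCons_one_eq_const, vecCons_one_eq_const]; exact 𝒞₂.onePoint_eq_zero m _ k _
      have h2 : qcdLatticeSchwinger ((reg₁.restrict ψ hψt).scheme m (𝒞₂.z m)
          (𝒞₂.shift m)) k 2 ![QCDField.pseudoRe f₁ f₂, QCDField.pseudoRe f₁ f₂]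
          ![thetaTest 4 𝒞₂.f₀, 𝒞₂.f₀] = 1 := hk
      rw [h2, h1, zero_mul, sub_zero, norm_one]


/-! ## The thin anchor is implied by the chiral lattice half -/

/-- **The chiral lattice half implies r4's thin anchor** (the full lattice gap restricts to the neutral sector): the thin
composition `thinQCD_of_thin` asks LESS of the anchor than `thinQCD_of_pieces_r5`. [folklore] -/
theorem thinLatticeAnchor_of_chiralLatticeHalf :
    (∀ Nf : ℕ, Nf = 2 ∨ Nf = 3 → ∃ reg : QCDRegularisation Nf,
          reg.HasMassScaling ∧ reg.IsChiralAtZero ∧ (reg.scheme 0 0 0).HasAsymptoticScaling ∧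
            ∀ m : Fin Nf → ℝ, (∀ f, 0 < m f) →
              (∀ f, ∀ᶠ k in Filter.atTop, -1 < (reg.scheme m 0 0).mq f k) ∧
                ∃ Δ > 0, (reg.scheme m 0 0).HasLatticeMassGap Δ) →
    (∀ Nf : ℕ, Nf = 2 ∨ Nf = 3 → ∃ reg : QCDRegularisation Nf,
          reg.HasMassScaling ∧ reg.IsChiralAtZero ∧ (reg.scheme 0 0 0).HasAsymptoticScaling ∧
            ∀ m : Fin Nf → ℝ, (∀ f, 0 < m f) →
              (∀ f, ∀ᶠ k in Filter.atTop, -1 < (reg.scheme m 0 0).mq f k) ∧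
                ∃ Δ₀ : ℝ, 0 < Δ₀ ∧ (reg.scheme m 0 0).HasNeutralLatticeMassGap Δ₀) := by
  intro h Nf hNf
  obtain ⟨reg, hms, hchi, has, hgap⟩ := h Nf hNf
  refine ⟨reg, hms, hchi, has, fun m hm => ?_⟩
  obtain ⟨hbr, Δ, hΔ, hg⟩ := hgap m hm
  exact ⟨hbr, Δ, hΔ, hg.neutral⟩

end Summit.QuantumFields.QCD.Theorems.ThinQCD.R5

end
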